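import Summits.ValiantsHypothesis.ValiantsHypothesis.Theorems.DepthWindowSparseTwoLevel
import HarnessLib

/-!
# Route `DepthWindow`, g8 — the two-level jump formula with FIXED-ENDPOINT path indices

Sequel of `Theorems/DepthWindowSparseTwoLevel.lean` (sliver lemma, NODE-v7 §6 (2)).  The explicit
`Σ Π^{[a]} Σ Π^{[b]}` formula `weightedHomogeneousComponent_prod_eq_twoLevel` carries its path
constraints as Kronecker-delta factors `[s 0 = x]·…·[s_b = y]`.  For the GATE REALISATION (one sum
gate per index, one product gate per path) the indices must be honest finite types: here the deltas
are resolved into the subtypes `PathsFix St n x y` of state paths with fixed endpoints, giving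
`weightedHomogeneousComponent_prod_eq_twoLevel_fix`:

`[∏_{l<t} U_l]_e = Σ_{(κ, y, S)} finVec y · ∏_{q<a} Σ_{s : (S_q ⇝ S_{q+1})} ∏_{u<b} (layer_{qb+u})_{s_u, s_{u+1}}`,

`κ ≤ e` the number of jump layers (`padLayers`), `S` an outer path `(0,0) ⇝ y` of length `a`, `s` an
inner path of length `b`.  This is exactly the input shape of a generic `Σ Π Σ Π` gate builder
(outer index type `Fin (e+1) × Σ_y PathsFix a (0,0) y`, inner index type `PathsFix b (S_q) (S_{q+1})`).
Pure algebra; nothing here bears on `VP ≠ VNP`.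

[cite: LimayeSrinivasanTavenas2025, Lemma 11] [cite: Burgisser2000, Def. 2.1]
-/

set_option linter.dupNamespace false

namespace Summit.ValiantsHypothesis.ValiantsHypothesis.Theorems.DepthWindow

open Finset MvPolynomial

/-- State paths of length `n` (so `n + 1` states) from `x` to `y`. -/
abbrev PathsFix (St : Type*) (n : ℕ) (x y : St) : Type _ :=
  {s : Fin (n + 1) → St // s 0 = x ∧ s (Fin.last n) = y}

/-- Resolving the two endpoint deltas of a path sum into a sum over `PathsFix`. -/
theorem sum_delta_mul_delta {St : Type*} [Fintype St] [DecidableEq St] {α : Type*} [CommSemiring α]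
    (n : ℕ) (x y : St) (F : (Fin (n + 1) → St) → α) :
    ∑ s : Fin (n + 1) → St, (if s 0 = x then 1 else 0) * F s * (if s (Fin.last n) = y then 1 else 0) =
      ∑ s : PathsFix St n x y, F s.1 := by
  have h : ∀ s : Fin (n + 1) → St,
      (if s 0 = x then 1 else 0) * F s * (if s (Fin.last n) = y then 1 else 0) =
        if s 0 = x ∧ s (Fin.last n) = y then F s else 0 := by
    intro s
    by_cases h0 : s 0 = x
    · by_cases h1 : s (Fin.last n) = y
      · rw [if_pos h0, if_pos h1, if_pos ⟨h0, h1⟩, one_mul, mul_one]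
      · rw [if_neg h1, if_neg (show ¬(s 0 = x ∧ s (Fin.last n) = y) from fun h => h1 h.2), mul_zero]
    · rw [if_neg h0, if_neg (show ¬(s 0 = x ∧ s (Fin.last n) = y) from fun h => h0 h.1), zero_mul, zero_mul]
  simp_rw [h]
  rw [← Finset.sum_filter]
  exact Finset.sum_subtype _ (by simp) _

/-- **Two-level jump formula, fixed-endpoint form.**  See the module docstring.
[cite: LimayeSrinivasanTavenas2025, Lemma 11] -/
theorem weightedHomogeneousComponent_prod_eq_twoLevel_fix {σ R : Type*} [CommRing R]
    (w : σ → ℕ) (d t e a b : ℕ) (he : e ≤ d) (hab : e ≤ a * b) (U : ℕ → MvPolynomial σ R) :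
    weightedHomogeneousComponent w e (∏ l ∈ range t, U l) =
      ∑ α : Fin (e + 1) × ((y : Fin (d + 1) × Fin (t + 1)) ×
              PathsFix (Fin (d + 1) × Fin (t + 1)) a ((0 : Fin (d + 1)), (0 : Fin (t + 1))) y),
        finVec w d t e U α.2.1 *
          ∏ q : Fin a, ∑ s : PathsFix (Fin (d + 1) × Fin (t + 1)) b (α.2.2.1 q.castSucc) (α.2.2.1 q.succ),
            pathWeight (fun u : Fin b =>
              padLayers (jumpMat w d t U) (α.1 : ℕ) (a * b) ⟨(q : ℕ) * b + u, blockIndex_lt q u⟩) s.1 := by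
  rw [weightedHomogeneousComponent_prod_eq_twoLevel w d t e a b he hab U]
  -- name the inner block sum with honest indices
  set G : ℕ → (Fin (a + 1) → Fin (d + 1) × Fin (t + 1)) → MvPolynomial σ R := fun κ S =>
    ∏ q : Fin a, ∑ s : PathsFix (Fin (d + 1) × Fin (t + 1)) b (S q.castSucc) (S q.succ),
      pathWeight (fun u : Fin b =>
        padLayers (jumpMat w d t U) κ (a * b) ⟨(q : ℕ) * b + u, blockIndex_lt q u⟩) s.1 with hG
  -- Step A/B: resolve inner and outer deltas on the left
  have hL : ∀ (κ : ℕ) (y : Fin (d + 1) × Fin (t + 1)),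
      (∑ S : Fin (a + 1) → Fin (d + 1) × Fin (t + 1),
        (if S 0 = ((0 : Fin (d + 1)), (0 : Fin (t + 1))) then 1 else 0) *
          (∏ q : Fin a, ∑ s : Fin (b + 1) → Fin (d + 1) × Fin (t + 1),
            (if s 0 = S q.castSucc then 1 else 0) *
              pathWeight (fun u : Fin b =>
                padLayers (jumpMat w d t U) κ (a * b) ⟨(q : ℕ) * b + u, blockIndex_lt q u⟩) s *
              (if s (Fin.last b) = S q.succ then 1 else 0)) *
          (if S (Fin.last a) = y then 1 else 0)) =
        ∑ S : PathsFix (Fin (d + 1) × Fin (t + 1)) a ((0 : Fin (d + 1)), (0 : Fin (t + 1))) y,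
          G κ S.1 := by
    intro κ y
    rw [← sum_delta_mul_delta a _ y (G κ)]
    refine Finset.sum_congr rfl fun S _ => ?_
    simp only [hG, sum_delta_mul_delta]
  simp_rw [hL]
  -- Step C: regroup the index types
  rw [← Fin.sum_univ_eq_sum_range, Fintype.sum_prod_type]
  refine Finset.sum_congr rfl fun κ _ => ?_
  rw [Fintype.sum_sigma]
  refine Finset.sum_congr rfl fun y _ => ?_
  rw [Finset.sum_mul]
  refine Finset.sum_congr rfl fun S _ => ?_
  rw [mul_comm]
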